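import Literature.MathematicalPhysics.QuantumLattice.InfVolFermionStateHubbardMeanEnergyBox
import Literature.MathematicalPhysics.QuantumLattice.HubbardStateSectorDecomposition
import Literature.MathematicalPhysics.QuantumLattice.HubbardBoxSectorEnergyBounds
import Literature.MathematicalPhysics.QuantumLattice.InfVolFermionStateCompactness
import Literature.MathematicalPhysics.QuantumLattice.InfVolFermionStateDensity
import Literature.MathematicalPhysics.QuantumLattice.InfVolFermionStateHubbardEnergy
import Literature.MathematicalPhysics.QuantumLattice.SectorEigenvalueContinuation
import HarnessLib

/-!
# The variational principle for the ground-state energy density of the 2D Hubbard model: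
# `energyDensity2D` is the least energy density of a translation-invariant state

Topic `Literature/MathematicalPhysics/QuantumLattice`; namespace
`Literature.MathematicalPhysics.QuantumLattice` (the file path). The thermodynamic limit
`e(n) = energyDensity2D t U n` of the canonical ground-state energy per site of the Hubbard model on
the two-dimensional tori (`HubbardTorus2DEnergyDensity.lean`) is a LOWER BOUND for the Hubbard energy
density `e(ω) = Re ω(E_Φ)` (`InfVolFermionState.hubbardEnergyDensity`) of EVERY translation-invariant
infinite-volume state `ω` of the lattice fermion system on `ℤ²` with particle density `n ∈ (0,2)`
(`U ≥ 0`):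

`InfVolFermionState.IsTranslationInvariant.energyDensity2D_le_hubbardEnergyDensity :
  energyDensity2D t U ω.density ≤ ω.hubbardEnergyDensity t U`.

Together with `IsTorusLimitOf.hubbardEnergyDensity_eq_energyDensity2D` (torus limits of sector
ground states ATTAIN `e(n)`) this is the infinite-volume variational principle for the ground-state
energy density — the Bratteli–Kishimoto–Robinson / Araki–Moriya characterisation of the
translation-invariant ground states as the minimisers of the mean energy, here at fixed density
and for the Hubbard model, with an elementary proof (Ruelle, *Statistical Mechanics* (1969) §2.4,
§3.3–3.4): restrict `ω` to the boxes `[0,ℓ)²`; the box Hamiltonian expectation is within `8|t|ℓ` of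
`ℓ² e(ω)` (`InfVolFermionStateHubbardMeanEnergyBox`), is at least the number-distribution average of
the sector ground energies (`HubbardStateSectorDecomposition`), and every sector ground energy of
the box lies above an affine minorant of `e` through `(n, e(n))`, up to `48|t|ℓ`
(`HubbardBoxSectorEnergyBounds`); the affine terms collapse by `Σ p_N = 1`, `Σ N p_N = ℓ² n`, and
`ℓ → ∞`. Conversely the bound is ATTAINED: unit ground states of `hubbardTorus 2 L t U` in the
sectors `(2⌊nL²/2⌋, S^z = 0)` exist at every side (`exists_unit_isGroundStateInSector_rectN`), and any
torus limit of them (compactness) is a translation-invariant even state of density `n` and energy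
density `energyDensity2D t U n` (`exists_isTranslationInvariant_hubbardEnergyDensity_eq`); so
`energyDensity2D t U ρ` is the least energy density of a translation-invariant state of density
`ρ ∈ (0,2)` (`isLeast_hubbardEnergyDensity_energyDensity2D`). Everything is PROVED; no definition,
no named fact.
-/

noncomputable section

namespace Literature.MathematicalPhysics.QuantumLattice

open Matrix Finset HubbardWave0 _root_.Filter Literature.Probability.LatticeModels ThermodynamicLimit
open scoped _root_.Topology ComplexOrder

namespace InfVolFermionState

variable {ω : InfVolFermionState 2}

/-! ### The expected particle number in a region of a translation-invariant state -/

/-- For translation-invariant `ω`, the one-site densities do not depend on the site: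
`ω(n_{xσ}) = ω(n_{0σ})`. [cite: ArakiMoriya2003, §4.1 Def. 4.5] -/
theorem IsTranslationInvariant.expect_nAt (hω : ω.IsTranslationInvariant) (x : Site 2) (σ : Fin 2) :
    ω.expect {x} (nAt x (mem_singleton_self x) σ) = ω.expect {0} (nAt 0 (mem_singleton_self 0) σ) := by
  conv_rhs => rw [← hω x, shift_expect]
  refine ω.expect_fermionEmbed_incl_eq (subset_refl {x}) (shiftSet_singleton_zero_subset x) _ _ ?_
  have hpt : ∀ (h : 0 + x ∈ ({x} : Finset (Site 2))) (h' : x ∈ ({x} : Finset (Site 2))),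
      (PolySite.pt (0 + x) h : PolySite ({x} : Finset (Site 2))) = PolySite.pt x h' := fun h h' =>
    Subtype.ext (congrArg toLex (zero_add x))
  simp only [fermionEmbed_numberOp, PolySite.shiftEmb_pt, PolySite.incl_pt]
  rw [hpt _ (mem_singleton_self x)]

/-- **The expected particle number of a region is `|Λ| × density`** for translation-invariant `ω`:
`Re ω(N_Λ) = |Λ| ρ(ω)`. [cite: BratteliRobinsonII1997, §6.2.4] -/
theorem IsTranslationInvariant.re_expect_totalNumber (hω : ω.IsTranslationInvariant) (Λ : Finset (Site 2)) :
    (ω.expect Λ (totalNumber : FermionOp Λ)).re = Λ.card * ω.density := by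
  let e : PolySite Λ ≃ {x // x ∈ Λ} :=
    ⟨fun a => ⟨ofLex a.1, PolySite.ofLex_mem a⟩, fun x => PolySite.pt x.1 x.2, fun a => PolySite.pt_ofLex a,
      fun x => Subtype.ext rfl⟩
  have hsum : (totalNumber : FermionOp Λ) =
      ∑ x ∈ Λ.attach, (numberOp (PolySite.pt x.1 x.2) 0 + numberOp (PolySite.pt x.1 x.2) 1) := by
    rw [totalNumber, ← Finset.univ_eq_attach]
    refine Fintype.sum_equiv e _ _ fun a => ?_
    rw [Fin.sum_univ_two, show PolySite.pt (e a).1 (e a).2 = e.symm (e a) from rfl, Equiv.symm_apply_apply]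
  have hterm : ∀ x : {x // x ∈ Λ},
      (ω.expect Λ (numberOp (PolySite.pt x.1 x.2) 0 + numberOp (PolySite.pt x.1 x.2) 1)).re = ω.density := by
    intro x
    have hcomp : ∀ σ : Fin 2, ω.expect Λ (numberOp (PolySite.pt x.1 x.2) σ) =
        ω.expect {x.1} (nAt x.1 (mem_singleton_self x.1) σ) := by
      intro σ
      rw [← ω.compatible (singleton_subset_iff.2 x.2) (nAt x.1 (mem_singleton_self x.1) σ), nAt,
        fermionEmbed_numberOp, PolySite.incl_pt]
    rw [map_add, hcomp, hcomp, hω.expect_nAt x.1 0, hω.expect_nAt x.1 1, ← map_add, density, densityAt]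
  rw [hsum, map_sum, Complex.re_sum, Finset.sum_congr rfl fun x _ => hterm x, sum_const, card_attach, nsmul_eq_mul]

/-! ### The variational lower bound -/

/-- **No translation-invariant state has energy density below the thermodynamic ground-state energy
density.** For the two-dimensional Hubbard model with `U ≥ 0` and hopping `t`: if `ω` is a
translation-invariant infinite-volume state of the lattice fermion system on `ℤ²` with particle
density `ρ(ω) ∈ (0, 2)`, then `energyDensity2D t U ρ(ω) ≤ e(ω)`, `e(ω)` its Hubbard energy density.
(Restrict to the boxes `[0,ℓ)²`: `Re ω(H_{[0,ℓ)²}) ≤ ℓ² e(ω) + 8|t|ℓ`; `Re ω(H) ≥ Σ_N p_N E(N)` with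
the number distribution `p_N` of `ω` in the box; every `E(N) ≥ ℓ² (e(ρ) + s (N/ℓ² - ρ)) - 48|t|ℓ`
for a supporting slope `s` of the convex `e` at `ρ` (the filled band `N = 2ℓ²` by
`E(2ℓ²) = U ℓ² ≥ ℓ²(e(ρ) + s(2 - ρ))`); summing with `Σ p_N = 1`, `Σ N p_N = ℓ² ρ` leaves
`ℓ² e(ρ) - 48|t|ℓ ≤ ℓ² e(ω) + 8|t|ℓ`, and `ℓ → ∞`.) Ruelle (1969) §2.4, §3.3–3.4;
Bratteli–Kishimoto–Robinson (1978) Thm. 2 / Araki–Moriya (2003) §7 for the general variational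
principle. [cite: Ruelle1969, §3.4] -/
theorem IsTranslationInvariant.energyDensity2D_le_hubbardEnergyDensity (hω : ω.IsTranslationInvariant)
    (t : ℝ) {U : ℝ} (hU : 0 ≤ U) (hρ0 : 0 < ω.density) (hρ2 : ω.density < 2) :
    energyDensity2D t U ω.density ≤ ω.hubbardEnergyDensity t U := by
  obtain ⟨s, hs⟩ := exists_supporting_line_energyDensity2D t hU hρ0 hρ2
  have hs2 := supporting_line_at_two_le t hU hs
  -- the estimate at side `ℓ ≥ 1`
  have hbox : ∀ ℓ : ℕ, 1 ≤ ℓ → (ℓ : ℝ) ^ 2 * energyDensity2D t U ω.density - 48 * |t| * ℓ ≤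
      (ℓ : ℝ) ^ 2 * ω.hubbardEnergyDensity t U + 8 * |t| * ℓ := by
    intro ℓ hℓ
    have hℓpos : (0 : ℝ) < ℓ := by exact_mod_cast hℓ
    have hℓ2 : (0 : ℝ) < (ℓ : ℝ) ^ 2 := by positivity
    have h48 : (0 : ℝ) ≤ 48 * |t| * ℓ := mul_nonneg (mul_nonneg (by norm_num) (abs_nonneg t)) hℓpos.le
    have hcardP : Fintype.card (PolySite (halfOpenBox 2 ℓ)) = ℓ * ℓ := by
      rw [card_polySite, card_halfOpenBox, sq]
    -- (4) the mean energy versus the free-boundary box Hamiltonian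
    have h4 := hω.abs_sq_mul_hubbardEnergyDensity_sub_re_expect_localHamiltonian_le t U ℓ
    rw [hubbardFermionInteraction_localHamiltonian, abs_le] at h4
    -- (1) the sector decomposition
    have h1 := ω.sum_re_expect_numberProj_mul_groundEnergyAt_le (halfOpenBox 2 ℓ) (polyGraph (halfOpenBox 2 ℓ)) t U
    -- (2) every sector of the box lies above the supporting line
    have h2 : ∀ N ∈ range (Fintype.card (Orb (PolySite (halfOpenBox 2 ℓ))) + 1),
        (ℓ : ℝ) ^ 2 * (energyDensity2D t U ω.density - s * ω.density) + s * N - 48 * |t| * ℓ ≤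
          groundEnergyAt (polyGraph (halfOpenBox 2 ℓ)) t U N := by
      intro N hN
      rw [mem_range, card_orb, Nat.lt_succ_iff] at hN
      rcases hN.lt_or_eq with hlt | rfl
      · rw [hcardP] at hlt
        have hx : (N : ℝ) / (ℓ : ℝ) ^ 2 ∈ Set.Ico (0 : ℝ) 2 := by
          refine ⟨by positivity, ?_⟩
          rw [div_lt_iff₀ hℓ2]
          have : (N : ℝ) < ((2 * (ℓ * ℓ) : ℕ) : ℝ) := by exact_mod_cast hlt
          push_cast at this
          linarith
        have hc : s * ((ℓ : ℝ) ^ 2 * ((N : ℝ) / (ℓ : ℝ) ^ 2)) = s * N := by rw [mul_div_cancel₀ _ hℓ2.ne']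
        linarith [mul_le_mul_of_nonneg_left (hs _ hx) hℓ2.le,
          sq_mul_energyDensity2D_le_groundEnergyAt_box t hU hℓ hlt]
      · rw [groundEnergyAt_polyGraph_full t U (halfOpenBox 2 ℓ), hcardP]
        push_cast
        linarith [mul_le_mul_of_nonneg_left hs2 hℓ2.le]
    -- (3) the average over the number distribution `p_N = Re ω(P_N)`
    have hp1 := ω.sum_re_expect_numberProj (halfOpenBox 2 ℓ)
    have hpN : ∑ N ∈ range (Fintype.card (Orb (PolySite (halfOpenBox 2 ℓ))) + 1),
        (N : ℝ) * (ω.expect (halfOpenBox 2 ℓ) (numberProj N)).re = (ℓ : ℝ) ^ 2 * ω.density := by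
      rw [ω.sum_mul_re_expect_numberProj, hω.re_expect_totalNumber, card_halfOpenBox, Nat.cast_pow]
    have h3 : (ℓ : ℝ) ^ 2 * energyDensity2D t U ω.density - 48 * |t| * ℓ ≤
        ∑ N ∈ range (Fintype.card (Orb (PolySite (halfOpenBox 2 ℓ))) + 1),
          (ω.expect (halfOpenBox 2 ℓ) (numberProj N)).re * groundEnergyAt (polyGraph (halfOpenBox 2 ℓ)) t U N := by
      calc (ℓ : ℝ) ^ 2 * energyDensity2D t U ω.density - 48 * |t| * ℓ
          = ∑ N ∈ range (Fintype.card (Orb (PolySite (halfOpenBox 2 ℓ))) + 1),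
              (ω.expect (halfOpenBox 2 ℓ) (numberProj N)).re *
                ((ℓ : ℝ) ^ 2 * (energyDensity2D t U ω.density - s * ω.density) + s * N - 48 * |t| * ℓ) := by
            have hexp : ∀ N : ℕ, (ω.expect (halfOpenBox 2 ℓ) (numberProj N)).re *
                ((ℓ : ℝ) ^ 2 * (energyDensity2D t U ω.density - s * ω.density) + s * N - 48 * |t| * ℓ) =
                ((ℓ : ℝ) ^ 2 * (energyDensity2D t U ω.density - s * ω.density) - 48 * |t| * ℓ) *
                    (ω.expect (halfOpenBox 2 ℓ) (numberProj N)).re +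
                  s * ((N : ℝ) * (ω.expect (halfOpenBox 2 ℓ) (numberProj N)).re) := fun N => by ring
            simp_rw [hexp]
            rw [Finset.sum_add_distrib, ← Finset.mul_sum, ← Finset.mul_sum, hp1, hpN]
            ring
        _ ≤ _ := Finset.sum_le_sum fun N hN =>
            mul_le_mul_of_nonneg_left (h2 N hN) (ω.re_expect_numberProj_nonneg _ N)
    linarith [h4.1]
  -- `ℓ → ∞`
  refine le_of_forall_pos_lt_add fun ε hε => ?_
  obtain ⟨ℓ, hℓ⟩ := exists_nat_gt (56 * |t| / ε)
  have h := hbox (ℓ + 1) (Nat.le_add_left 1 ℓ)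
  push_cast at h
  have hL : 56 * |t| / ε < (ℓ : ℝ) + 1 := hℓ.trans (lt_add_one _)
  rw [div_lt_iff₀ hε] at hL
  have hLpos : (0 : ℝ) < (ℓ : ℝ) + 1 := by positivity
  by_contra hcon
  push Not at hcon
  nlinarith [mul_le_mul_of_nonneg_left hcon (sq_nonneg ((ℓ : ℝ) + 1)), mul_pos (sub_pos.2 hL) hLpos]

/-! ### Attainment: torus limits of sector ground states realise `energyDensity2D` -/

/-- **Unit sector ground states exist**: for `n ≤ 2` and every side `L`, the Hubbard torus
`hubbardTorus 2 L t U` has a unit ground state in the joint sector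
`(N, S^z) = (2⌊n L²/2⌋, 0)` (the sector is non-empty since `⌊n L²/2⌋ ≤ L²`, finite-dimensional
and `H`-invariant). [cite: LiebPRL1989, eqs. (1)–(2)] -/
theorem exists_unit_isGroundStateInSector_rectN (t U : ℝ) {n : ℝ} (hn2 : n ≤ 2) (L : ℕ) :
    ∃ ψ : Fock (Orb (FermionTorus 2 L)), star ψ ⬝ᵥ ψ = 1 ∧
      IsGroundStateInSector (hubbardTorus 2 L t U) (rectN n L) 0 ψ := by
  have hm : ⌊n * (L : ℝ) ^ 2 / 2⌋₊ ≤ Fintype.card (FermionTorus 2 L) := by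
    rw [show Fintype.card (FermionTorus 2 L) = L ^ 2 by simp]
    refine Nat.floor_le_of_le ?_
    push_cast
    nlinarith [sq_nonneg (L : ℝ)]
  obtain ⟨⟨ψ, hψS, hψ0, hH⟩, -⟩ := szSector_groundState (fermionTorusGraph 2 L) t U hm
  obtain ⟨c, hc, -, hc1⟩ := EigenvalueContinuation.exists_normalize hψ0
  refine ⟨(c : ℂ) • ψ, hc1, Submodule.smul_mem _ _ hψS, smul_ne_zero (by exact_mod_cast hc.ne') hψ0, ?_⟩
  rw [mulVec_smul]
  exact (congrArg ((c : ℂ) • ·) hH).trans (smul_comm _ _ _)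

/-- **Ruelle's energy density is attained by a translation-invariant even state of the right
density.** For `U ≥ 0` and `0 ≤ n < 2` there is a translation-invariant, even infinite-volume state
`ω` on `ℤ²` with `ρ(ω) = n` and `e(ω) = energyDensity2D t U n` — any torus limit (compactness,
`InfVolFermionState.exists_isTorusLimitOf_subseq_of_isNParticle`) of unit sector ground states in
the sectors `(2⌊n L²/2⌋, 0)`. [cite: Ruelle1969, §3.4] -/
theorem exists_isTranslationInvariant_hubbardEnergyDensity_eq (t : ℝ) {U : ℝ} (hU : 0 ≤ U) {n : ℝ}
    (hn0 : 0 ≤ n) (hn2 : n < 2) :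
    ∃ ω : InfVolFermionState 2, ω.IsTranslationInvariant ∧ ω.IsEven ∧ ω.density = n ∧
      ω.hubbardEnergyDensity t U = energyDensity2D t U n := by
  choose ψ hψ using exists_unit_isGroundStateInSector_rectN t U hn2.le
  have hN : ∀ L, IsNParticle (rectN n L) (ψ L) := fun L => ((mem_szSector_iff _ _ _).1 (hψ L).2.1).1
  obtain ⟨φ, hφ, ω, hω, hti, hev⟩ :=
    InfVolFermionState.exists_isTorusLimitOf_subseq_of_isNParticle ψ hN tendsto_id fun j => (hψ j).1
  have hφ' : Tendsto (id ∘ φ) atTop atTop := hφ.tendsto_atTop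
  exact ⟨ω, hti, hev, hω.density_eq_of_rectN hφ' hn0 (fun j => hN _) fun j => (hψ _).1,
    hω.hubbardEnergyDensity_eq_energyDensity2D (t := t) hφ' hU hn0 hn2 (fun j => (hψ _).2) fun j => (hψ _).1⟩

/-- **The variational principle for the ground-state energy density of the 2D Hubbard model.**
For `U ≥ 0` and `0 < ρ < 2`, Ruelle's thermodynamic limit `energyDensity2D t U ρ` of the
ground-state energy per site is the LEAST Hubbard energy density of a translation-invariant
infinite-volume state of particle density `ρ` (lower bound:
`IsTranslationInvariant.energyDensity2D_le_hubbardEnergyDensity`; attained, by an even state: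
`exists_isTranslationInvariant_hubbardEnergyDensity_eq`). Bratteli–Kishimoto–Robinson (1978)
Thm. 2 / Bratteli–Robinson II Thm. 6.2.58 (ground states of lattice systems minimise the mean
energy); Ruelle (1969) §3.4. [cite: BratteliKishimotoRobinson1978, §3 Thm. 2] -/
theorem isLeast_hubbardEnergyDensity_energyDensity2D (t : ℝ) {U : ℝ} (hU : 0 ≤ U) {ρ : ℝ} (hρ0 : 0 < ρ)
    (hρ2 : ρ < 2) :
    IsLeast {e : ℝ | ∃ ω : InfVolFermionState 2, ω.IsTranslationInvariant ∧ ω.density = ρ ∧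
      ω.hubbardEnergyDensity t U = e} (energyDensity2D t U ρ) := by
  refine ⟨?_, fun e he => ?_⟩
  · obtain ⟨ω, hti, -, hdens, he⟩ := exists_isTranslationInvariant_hubbardEnergyDensity_eq t hU hρ0.le hρ2
    exact ⟨ω, hti, hdens, he⟩
  · obtain ⟨ω, hti, hdens, he⟩ := he
    rw [← he, ← hdens]
    rw [← hdens] at hρ0 hρ2
    exact hti.energyDensity2D_le_hubbardEnergyDensity t hU hρ0 hρ2

end InfVolFermionState

end Literature.MathematicalPhysics.QuantumLattice

end
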